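import Mathlib

/-!
# Crux `ExactCertificate` (stmt-AtomisticToContinuum-11959), line `closure-makes-nogap-exact`,
# skeleton X (`AllTemplates`): stub `stub_expSumWindow` (X1)

Support file for the crux `ThreeConeCertificate.ExactCertificate`, skeleton X
(`Cruxes.ExactCertificate.AllTemplates`: the commensurability caveat of skeletons VIII–IX removed
by a Vandermonde window argument).  On each lattice line the structure factor of a periodic
configuration is an exponential sum `Σ_{a ∈ s} C(a)·aⁿ` over finitely many NONZERO complex nodes;
the present stub is the window statement: if the coefficients do not all vanish on `s`, then
among any `#s` consecutive integers `n` some `Σ_{a ∈ s} C(a)·aⁿ ≠ 0`.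

Proof.  Index `s` by `Fin #s` (`s.equivFin`), nodes `v : Fin #s → ℂ` injective.  If the sum
vanished for `n = n₀, …, n₀ + #s − 1`, then the vector `d i := C (v i) · (v i)^{n₀}` satisfies
`d ᵥ* vandermonde v = 0` (`Matrix.vecMul`); the Vandermonde determinant is non-zero (`v`
injective), so `d = 0`, hence `C (v i) = 0` for all `i` (as `v i ≠ 0`), contradicting the
hypothesis.  Pure Mathlib, private helpers only.  All `[folklore]`.
-/

noncomputable section

namespace Summit.AtomisticToContinuum.Crystallization.Theorems.ThreeConeCertificateExactCertificate.AllTemplates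

open scoped BigOperators

/-- Vandermonde step: if `Σ_{a ∈ s} C(a)·a^{n₀ + t} = 0` for `t = 0, …, #s − 1` and all nodes of
`s` are non-zero, then `C` vanishes on `s`. [folklore] -/
private theorem coeff_eq_zero_of_window (s : Finset ℂ) (C : ℂ → ℂ) (hs : ∀ a ∈ s, a ≠ 0)
    (n₀ : ℤ) (h : ∀ t : ℕ, t < s.card → ∑ a ∈ s, C a * a ^ (n₀ + t) = 0) :
    ∀ a ∈ s, C a = 0 := by
  -- index the nodes by `Fin #s`
  set e : Fin s.card ≃ s := s.equivFin.symm
  set v : Fin s.card → ℂ := fun i => ((e i : s) : ℂ) with hv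
  have hvinj : Function.Injective v := Subtype.val_injective.comp e.injective
  have hv0 : ∀ i, v i ≠ 0 := fun i => hs _ (e i).2
  -- the row vector `d` killed by the Vandermonde matrix
  set d : Fin s.card → ℂ := fun i => C (v i) * v i ^ n₀ with hd
  have hdV : Matrix.vecMul d (Matrix.vandermonde v) = 0 := by
    funext j
    rw [Pi.zero_apply, ← h j j.isLt, ← Finset.sum_coe_sort s]
    simp only [Matrix.vecMul, dotProduct, Matrix.vandermonde_apply]
    refine Fintype.sum_equiv e _ _ fun i => ?_
    rw [hd, hv]
    simp only
    rw [zpow_add₀ (hv0 i), zpow_natCast, mul_assoc]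
  have hdet : (Matrix.vandermonde v).det ≠ 0 := Matrix.det_vandermonde_ne_zero_iff.2 hvinj
  have hd0 : d = 0 := Matrix.eq_zero_of_vecMul_eq_zero hdet hdV
  intro a ha
  have hi : v (e.symm ⟨a, ha⟩) = a := by
    rw [hv]
    simp only [Equiv.apply_symm_apply]
  have := congr_fun hd0 (e.symm ⟨a, ha⟩)
  rw [hd, Pi.zero_apply] at this
  simp only at this
  rw [hi] at this
  rcases mul_eq_zero.1 this with h0 | h0
  · exact h0
  · exact absurd h0 (zpow_ne_zero n₀ (hs a ha))

/-- Stub X1 (exponential sums do not vanish on a window of length = number of nodes): for a finite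
set `s` of NONZERO complex nodes and coefficients not all zero on `s`, among any `#s` consecutive
integers `n` some `Σ_{a ∈ s} C(a)·aⁿ ≠ 0` (Vandermonde). [folklore] -/
theorem stub_expSumWindow : ∀ (s : Finset ℂ) (C : ℂ → ℂ), (∀ a ∈ s, a ≠ 0) → (∃ a ∈ s, C a ≠ 0) →
      ∀ n₀ : ℤ, ∃ n : ℤ, n₀ ≤ n ∧ n < n₀ + s.card ∧ ∑ a ∈ s, C a * a ^ n ≠ 0 := by
  intro s C hs hC n₀
  by_contra hcon
  push Not at hcon
  obtain ⟨a, ha, hCa⟩ := hC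
  exact hCa (coeff_eq_zero_of_window s C hs n₀
    (fun t ht => hcon (n₀ + t) (by omega) (by omega)) a ha)

end Summit.AtomisticToContinuum.Crystallization.Theorems.ThreeConeCertificateExactCertificate.AllTemplates
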